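/-
Copyright (c) 2026 the pub-hodgecm-mathlib formalisation cell (harness21).  Prover seat hodgecm-mathlib-LH4-p19 (g2), req620 Track A «(D-RAM) FOUR-FRAME» squad
(STAGE-1b, row (2) of the piece `f_{T₊}`, the (β₂) road (R-36) «PURE-CELL LEDGER»; β₂ sub-dealer LH4-p04 (g9) BETA2-BOARD v2 rows (ROW-D♭) ∕ (ROW-SMALL-2), dealt by name; the
socket from the lattice count to the weighted cone-ledger difference of the diagonal cell), 2026-09-04.
-/
import Summits.HodgeConjecture.HodgeConjecture.Theorems.F0P3cDyRamDiagonalCellBalancedCount   -- ★ (this seat, K6c): `ncard_cls_affine_eq_ncard_cls_not_affine`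
import Summits.HodgeConjecture.HodgeConjecture.Theorems.F0P3cDyRamConeCellFaceTubeAbove      -- ★ (LH4-p16 (g0)) HEAD-hi `finsum_levelSetDep_inter_weight_eq_iff_of_le` (weighted face ⟺ populated balance, `d ≤ b`)
import Summits.HodgeConjecture.HodgeConjecture.Theorems.F0P3cDyRamConeCellDiagonalSize       -- ★ (LH4-p09 (g9)) `levelSetDep_diag_eq_levelSet` (the diagonal cell passes the depth condition)
import HarnessLib

/-!
# Crux `H413`, line LH4 «(D-RAM) FOUR-FRAME» — STAGE-1b, row (2), the (β₂) road (R-36), lane B, rows (ROW-D♭) ∕ (ROW-SMALL-2), THE SOCKET — «THE WEIGHTED TWO-LITERAL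
# DIFFERENCE OF THE DIAGONAL CELL VANISHES ONCE ITS TWO LABELS ARE READ AS (class of T, affine label of V̂)»

Cell `hodgecm-mathlib` (D-0151), FLOOR 0, crux item H413 = `stmt-HodgeConjecture-24833`, route of record `HCCMUnconditional`; squad F0∕P3c∕LH4; lane
`--supports stmt-HodgeConjecture-24833 --as helper` (count-neutral; pays NO tier-0 row).  THEOREMS ONLY (no `def`, no instance, no notation, no `sorry`, default heartbeats);
★-only imports; states NO law; (β₂) stays a HYPOTHESIS.  FRAME = ★ `…ConeCellFaceTubeAbove`'s VERBATIM (the E-side wild datum, the line model `(M, jE, ρ, Θ, α; φ, lam, h)`, the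
weight letter `hf` of ★ (C1)) + the diagonal depth letters `hm hjl` of ★ `…ConeCellDiagonalSize` + ★ K6c's RamK∕pivot∕affine∕digit letters; the two cone-ledger literals of the
cell enter as ABSTRACT predicates `P₁ Q₁ : AddSubgroup M → Prop` together with their READS (hypotheses `hL₁ hL₂`) and the populatedness read `hP`.

WHY (β₂-BOARD v2 (ROW-D♭) «`cellDiff_t(m∕2, m∕2) = 0`», WORD #19 (ROW-SMALL-2); this seat's K1–K6).  In `beta2ConesB.letter.v2` ∕ `OFF.letter.v2` the diagonal cell `(b, b)` of the live
row contributes `X(b,b) = Σᶠ_{Λ ∈ cell ∩ {q⁺}} f b b Λ − Σᶠ_{Λ ∈ cell ∩ {q⁻}} f b b Λ`, `cell = levelSetDep ρ Θ α (jE ϖ) h b b (lam − jE u)`, `f b b Λ = #Sol_{2b}(r_Λ)`.  AT AND ABOVE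
THE GLUE CONDUCTOR (`d ≤ b`) ★ HEAD-hi makes this the UNWEIGHTED balance `#{cell ∣ q⁺ ∧ f ≠ 0} = #{cell ∣ q⁻ ∧ f ≠ 0}`; ★ `levelSetDep_diag_eq_levelSet` makes `cell` the u-free
diagonal cell `D = levelSet … b b` (`2b ≤ m`); and once (hP) populatedness `f ≠ 0` is read as «the class of `T(x₀)` is `ε`» and (hL₁)(hL₂) the literals on populated lattices are
read as «the affine label `ω_σ(α₁ + γ₁V̂(x₀))` is `+1` ∕ is not `+1`», the two sets are ★ K6c's and `X(b,b) = 0`.  The reads are NOT proved here: (hP) is ★ FaceTube's canonical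
glue unit `jE r₀ = glueUnit(x₀, b)` + ★ K3 `glueUnit_mul_eq_neg_trace` + ★ T1 norm-gating + ★ K5c independence; (hL₁)(hL₂) are LH4-p16 (g2)'s ★ p863048 `VS_{m*} = valueSetMod … (e′ • X₊)`
+ ★ p862871 `rayScalar_eq_affine` + ★ p862927 + the two shell letters of the literals on `D` — dischargers to follow ∕ to be socketed by the β₂ sub-dealer.
* §1 `sep_pop_eq_setOf_gen_of_reads` — under the reads, `{Λ ∈ cell ∣ P Λ ∧ f b b Λ ≠ 0}` IS ★ K6c's set `{Λ ∣ ∃ x₀ gen, (cls ↔ ε) ∧ ∃ V̂, jE V̂ = V(x₀) ∧ lab V̂}`.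
* §2 HEAD `cellDiff_diag_eq_zero_of_reads` — `((Σᶠ_{cell ∩ {P₁}} f b b : ℕ) : ℤ) − ((Σᶠ_{cell ∩ {Q₁}} f b b : ℕ) : ℤ) = 0`.
WHAT IS NOT CLAIMED: the reads (hP)(hL₁)(hL₂); the instantiation `P₁ := q⁺`, `Q₁ := q⁻` of `OFF.letter.v2` (prefix P); any statement off the diagonal or outside `1 ≤ g`, `g + 1 ≤ d`.
HONEST LABEL.  Count-neutral lattice bookkeeping; nothing printed is asserted; no census law is stated; `HC_CM` is proved only modulo the 7 printed citations (2 remaining named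
inputs: hLiu418 = `stmt-HodgeConjecture-24832`, h413 = `stmt-HodgeConjecture-24833`) until rung 0 closes.
## References
* [Kottwitz1986BaseChangeUnits] R. E. Kottwitz, *Base change for unit elements of Hecke algebras*, Compositio Math. 60 (1986): §1 pp. 240–241 (fixed-lattice counts).
* [Rogawski1990] J. D. Rogawski, *Automorphic Representations of Unitary Groups in Three Variables*, Ann. of Math. Stud. 123 (1990): §4.9 Prop. 4.9.1 (b) p. 55, §12.2.
* [LabesseLanglands1979] J.-P. Labesse, R. P. Langlands, *L-indistinguishability for SL(2)*, Canad. J. Math. 31 (1979): §2 (2.2) p. 9 (κ-signed counts).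
* [Jacobowitz1962] R. Jacobowitz, *Hermitian forms over local fields*, Amer. J. Math. 84 (1962): §4 (dual lattices, gluing).
* [Serre1979] J.-P. Serre, *Local Fields*, GTM 67 (1979): Ch. V §3 Cor. 3 pp. 85–87, Ch. XV §2 (norm classes).
-/

set_option autoImplicit false

noncomputable section

namespace Summit.HodgeConjecture.HodgeConjecture.Cruxes.H413.F0P3cDyRamDiagonalCellRowSocket

open scoped Valued WithZero Matrix MatrixGroups
open WithZero
open Literature.NumberTheory.Automorphic Literature.NumberTheory.Automorphic.HermitianLattice Literature.NumberTheory.Automorphic.UnitaryLatticeTree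
open Literature.NumberTheory.Automorphic.UnitaryThreeFourFrame (IsRamifiedQuadraticDatum normSign)
open Summit.HodgeConjecture.HodgeConjecture.Cruxes.H413.F0P3cDyRamToricCensusDefs
open Summit.HodgeConjecture.HodgeConjecture.Cruxes.H413.F0P3cDyRamFourFramePieces (mstarOfRecord)
open Summit.HodgeConjecture.HodgeConjecture.Cruxes.H413.F0P3cDyRamConeCellFaceTubeAbove (finsum_levelSetDep_inter_weight_eq_iff_of_le)
open Summit.HodgeConjecture.HodgeConjecture.Cruxes.H413.F0P3cDyRamConeCellDiagonalSize (levelSetDep_diag_eq_levelSet)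
open Summit.HodgeConjecture.HodgeConjecture.Cruxes.H413.F0P3cDyRamDiagonalCellBalancedCount (ncard_cls_affine_eq_ncard_cls_not_affine)

variable {E M : Type} [Field E] [Valued E ℤᵐ⁰] [Field M] [Valued M ℤᵐ⁰] {σ : E →+* E} {ρ Θ : M →+* M} {α : M}

/-! ## §1 Under the reads, the populated labelled part of the cell is ★ K6c's set -/

omit [Valued E ℤᵐ⁰] in
/-- **THE POPULATED LABELLED PART OF THE DIAGONAL CELL, READ.**  One-field RamK letters (`ρ`, `Θ` commuting isometric involutions, `|α| ≤ 1`, `|α − ρα| = 1`, `ρϖE = ϖE`,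
`|ϖE| = exp(−1)`, `h ≠ 0`), the depth letters `|μ| = exp(−m)`, `|μ − ρμ| = exp(−jl)`, `1 ≤ b`, `2b ≤ m` (so `levelSetDep(b, b; μ) = levelSet(b, b)`, ★); a weight `w`, a class
predicate `CLS`, a coordinate `Vf`, a label `lab` on `E`, a cell predicate `P`, and the two READS on generators of lattices of the cell — (hP) `w Λ ≠ 0 ↔ (CLS x₀ ↔ ε)`, (hL) for
`w Λ ≠ 0`: `P Λ ↔ ∃ V̂, jE V̂ = Vf x₀ ∧ lab V̂`.  THEN `{Λ ∈ levelSetDep(b, b; μ) ∣ P Λ ∧ w Λ ≠ 0} = {Λ ∣ ∃ x₀, gen_b(Λ, x₀) ∧ (CLS x₀ ↔ ε) ∧ ∃ V̂, jE V̂ = Vf x₀ ∧ lab V̂}`.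
[cite: Kottwitz1986BaseChangeUnits, §1 pp. 240–241] [cite: Jacobowitz1962, §4] -/
theorem sep_pop_eq_setOf_gen_of_reads (hρρ : ∀ x, ρ (ρ x) = x) (hvρ : ∀ x, Valued.v (ρ x) = Valued.v x) (hΘΘ : ∀ x, Θ (Θ x) = x)
    (hΘρ : ∀ x, Θ (ρ x) = ρ (Θ x)) (hvΘ : ∀ x, Valued.v (Θ x) = Valued.v x) (hα1 : Valued.v α ≤ 1) (hU : Valued.v (α - ρ α) = 1)
    {ϖE h : M} (hρϖE : ρ ϖE = ϖE) (hϖE : Valued.v ϖE = exp (-1 : ℤ)) (hh : h ≠ 0)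
    {μ : M} {m jl : ℕ} (hm : Valued.v μ = exp (-(m : ℤ))) (hjl : Valued.v (μ - ρ μ) = exp (-(jl : ℤ))) {b : ℕ} (hb : 1 ≤ b) (h2b : 2 * b ≤ m)
    (w : AddSubgroup M → ℕ) (CLS : M → Prop) (Vf : M → M) (ε : Prop) (jE : E →+* M) (lab : E → Prop) (P : AddSubgroup M → Prop)
    (hP : ∀ (Λ : AddSubgroup M) (x₀ : M), (x₀ ≠ 0 ∧ (∀ x, x ∈ Λ ↔ ∃ ζ, IsOrd ρ α (ϖE ^ b) ζ ∧ x = x₀ * ζ) ∧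
        IsOrd ρ α (ϖE ^ b) (dualGen ρ Θ α (ϖE ^ b) h x₀) ∧ ¬ IsOrd ρ α (ϖE ^ b) (dualGen ρ Θ α (ϖE ^ b) h x₀ / ϖE) ∧
        Valued.v (dualGen ρ Θ α (ϖE ^ b) h x₀) = Valued.v ϖE ^ b) → (w Λ ≠ 0 ↔ (CLS x₀ ↔ ε)))
    (hL : ∀ (Λ : AddSubgroup M) (x₀ : M), (x₀ ≠ 0 ∧ (∀ x, x ∈ Λ ↔ ∃ ζ, IsOrd ρ α (ϖE ^ b) ζ ∧ x = x₀ * ζ) ∧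
        IsOrd ρ α (ϖE ^ b) (dualGen ρ Θ α (ϖE ^ b) h x₀) ∧ ¬ IsOrd ρ α (ϖE ^ b) (dualGen ρ Θ α (ϖE ^ b) h x₀ / ϖE) ∧
        Valued.v (dualGen ρ Θ α (ϖE ^ b) h x₀) = Valued.v ϖE ^ b) → w Λ ≠ 0 → (P Λ ↔ ∃ Ve : E, jE Ve = Vf x₀ ∧ lab Ve)) :
    {Λ ∈ levelSetDep ρ Θ α ϖE h b b μ | P Λ ∧ w Λ ≠ 0} =
      {Λ : AddSubgroup M | ∃ x₀ : M, (x₀ ≠ 0 ∧ (∀ x, x ∈ Λ ↔ ∃ ζ, IsOrd ρ α (ϖE ^ b) ζ ∧ x = x₀ * ζ) ∧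
        IsOrd ρ α (ϖE ^ b) (dualGen ρ Θ α (ϖE ^ b) h x₀) ∧ ¬ IsOrd ρ α (ϖE ^ b) (dualGen ρ Θ α (ϖE ^ b) h x₀ / ϖE) ∧
        Valued.v (dualGen ρ Θ α (ϖE ^ b) h x₀) = Valued.v ϖE ^ b) ∧ (CLS x₀ ↔ ε) ∧ ∃ Ve : E, jE Ve = Vf x₀ ∧ lab Ve} := by
  rw [levelSetDep_diag_eq_levelSet hρρ hvρ hΘΘ hΘρ hvΘ hα1 hU hρϖE hϖE hh hm hjl hb h2b]
  ext Λ
  rw [Set.mem_sep_iff, mem_levelSet_iff, Set.mem_setOf_eq]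
  constructor
  · rintro ⟨⟨x₀, hG⟩, hPΛ, hw⟩
    exact ⟨x₀, hG, (hP Λ x₀ hG).1 hw, (hL Λ x₀ hG hw).1 hPΛ⟩
  · rintro ⟨x₀, hG, hC, hV⟩
    have hw : w Λ ≠ 0 := (hP Λ x₀ hG).2 hC
    exact ⟨⟨x₀, hG⟩, (hL Λ x₀ hG hw).2 hV, hw⟩

/-! ## §2 HEAD — the socket: the weighted two-literal difference of the diagonal cell vanishes under the reads -/

/-- **HEAD — «THE WEIGHTED TWO-LITERAL DIFFERENCE OF THE DIAGONAL CELL VANISHES UNDER THE READS».**  Frame of ★ `…ConeCellFaceTubeAbove` VERBATIM (E-side wild datum, complete,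
finite residue field, `|2| < 1`; plane `(H₂, h_W)`; line model `jE ρ Θ α φ lam h`; weight letter `hf` of ★ (C1); `u : E`, `1 ≤ b`, `d ≤ b`, `IsOrd ρ α (jEϖ^b) lam`) + the diagonal
depth letters (`|lam − jE u| = exp(−m)`, `|(lam − jE u) − ρ(lam − jE u)| = exp(−jl)`, `2b ≤ m`, `|α − ρα| = 1`) + ★ K6c's letters (`hjiso`, RamK datum `IsRamifiedQuadraticDatum Θ (jE ϖ) d t_M`,
`[CompleteSpace M] [Finite 𝓀[M]]`, `|2|_M < 1`, `hFN`, pivot `θ₀`, `|α − Θα| < 1`, `m* ≤ 2b`, affine letters `α₁ γ₁ g` with `1 ≤ g`, `g + 1 ≤ d`, digit systems `R_d R′`, `ε`), two cell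
predicates `P₁ Q₁` and their READS on generators of populated lattices of the cell: (hP) `f b b Λ ≠ 0 ↔ ((∃ c, ρc = c ∧ cΘc = T(x₀)) ↔ ε)`, (hL₁) `P₁ Λ ↔ ∃ V̂, jE V̂ = V(x₀) ∧
ω_σ(α₁ + γ₁V̂) = 1`, (hL₂) `Q₁ Λ ↔ ∃ V̂, jE V̂ = V(x₀) ∧ ω_σ(α₁ + γ₁V̂) ≠ 1` (`T(x₀) = Tr_ρ ŵ`, `V(x₀) = Tr_ρ(θ₀ŵ)∕Tr_ρ ŵ`, `ŵ = (ν·h·x₀Θx₀)⁻¹`).  THEN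
`((Σᶠ_{Λ ∈ cell ∩ {P₁}} f b b Λ : ℕ) : ℤ) − ((Σᶠ_{Λ ∈ cell ∩ {Q₁}} f b b Λ : ℕ) : ℤ) = 0`, `cell = levelSetDep ρ Θ α (jE ϖ) h b b (lam − jE u)` (★ HEAD-hi ∘ §1 ∘ ★ K6c).
[cite: Kottwitz1986BaseChangeUnits, §1 pp. 240–241] [cite: Rogawski1990, §4.9 Prop. 4.9.1 (b) p. 55] [cite: LabesseLanglands1979, §2 (2.2) p. 9] [cite: Serre1979, Ch. XV §2] -/
theorem cellDiff_diag_eq_zero_of_reads [CompleteSpace E] [IsDiscreteValuationRing 𝒪[E]] [Finite 𝓀[E]] [CompleteSpace M] [Finite 𝓀[M]]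
    (σ : E →+* E) (hσ : ∀ a, σ (σ a) = a) (hvσ : ∀ a, Valued.v (σ a) = Valued.v a)
    {ϖ : E} (hϖ : Valued.v ϖ = WithZero.exp (-1 : ℤ)) {d t : ℕ} (hD : IsRamifiedQuadraticDatum σ ϖ d t) (h2v : Valued.v (2 : E) < 1)
    {H₂ : Matrix (Fin 2) (Fin 2) E} (hH₂σ : (H₂.map σ)ᵀ = H₂) {hW : E} (hhW : Valued.v hW = 1) (hhWσ : σ hW = hW) (jE : E →+* M)
    (hρρ : ∀ x, ρ (ρ x) = x) (hvρ : ∀ x, Valued.v (ρ x) = Valued.v x) (hα : ρ α ≠ α) (hα1 : Valued.v α ≤ 1)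
    (hint : ∀ z : M, Valued.v z ≤ 1 → Valued.v ((z - ρ z) / (α - ρ α)) ≤ 1)
    (hΘΘ : ∀ x, Θ (Θ x) = x) (hΘρ : ∀ x, Θ (ρ x) = ρ (Θ x)) (hvΘ : ∀ x, Valued.v (Θ x) = Valued.v x) (hΘj : ∀ x, Θ (jE x) = jE (σ x))
    (hjv : ∀ c, Valued.v (jE c) ≤ 1 ↔ Valued.v c ≤ 1) (hjfix : ∀ z, ρ z = z ↔ ∃ c, jE c = z)
    (hjpow : ∀ (t : E) (n : ℤ), Valued.v (jE t) = Valued.v (jE ϖ) ^ n ↔ Valued.v t = Valued.v ϖ ^ n)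
    (hϖmax : ∀ t : M, ρ t = t → Valued.v t < 1 → Valued.v t ≤ Valued.v (jE ϖ))
    (φ : (Fin 2 → E) →+ M) (hφs : ∀ (c : E) (x : Fin 2 → E), φ (c • x) = jE c * φ x) (hφi : Function.Injective φ) (hφo : Function.Surjective φ)
    {γ₂ : GL (Fin 2) E} {lam h : M} (hφγ : ∀ x, φ ((γ₂ : Matrix (Fin 2) (Fin 2) E).mulVec x) = lam * φ x) (hlam : Valued.v lam = 1)
    (hΘh : Θ h = h) (hh : h ≠ 0) (hform : ∀ x y, jE (pairing σ H₂ x y) = h * Θ (φ x) * φ y + ρ (h * Θ (φ x) * φ y))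
    (u : E) {b : ℕ} (hb : 1 ≤ b) (hdb : d ≤ b) (hlamb : IsOrd ρ α (jE ϖ ^ b) lam)
    (f : ℕ → ℕ → AddSubgroup M → ℕ)
    (hf : ∀ (b j : ℕ) (Λ : AddSubgroup M) (x₀ : M) (r : E), 1 ≤ b → x₀ ≠ 0 →
      (∀ x, x ∈ Λ ↔ ∃ z, IsOrd ρ α (jE ϖ ^ j) z ∧ x = x₀ * z) →
      IsOrd ρ α (jE ϖ ^ j) (dualGen ρ Θ α (jE ϖ ^ j) h x₀) → ¬ IsOrd ρ α (jE ϖ ^ j) (dualGen ρ Θ α (jE ϖ ^ j) h x₀ / jE ϖ) →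
      Valued.v (dualGen ρ Θ α (jE ϖ ^ j) h x₀) = Valued.v (jE ϖ) ^ b →
      (∀ b', (∀ x ∈ Λ, Valued.v (h * Θ x * b' + ρ (h * Θ x * b')) ≤ 1) → (lam - jE u) * b' ∈ Λ) →
      IsOrd ρ α (jE ϖ ^ j) lam → jE r = glueUnit ρ Θ α (jE ϖ ^ j) h (jE ϖ) (jE hW) x₀ b →
      f b j Λ = Nat.card {x : 𝒪[E] ⧸ 𝓂[E] ^ (2 * b) // ∃ u' : 𝒪[E], Ideal.Quotient.mk (𝓂[E] ^ (2 * b)) u' = x ∧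
        Valued.v ((u' : E) * σ u' - r) ≤ Valued.v (ϖ ^ (2 * b))})
    -- the diagonal depth letters
    {m jl : ℕ} (hm : Valued.v (lam - jE u) = exp (-(m : ℤ))) (hjl : Valued.v ((lam - jE u) - ρ (lam - jE u)) = exp (-(jl : ℤ)))
    (h2b : 2 * b ≤ m) (hU : Valued.v (α - ρ α) = 1)
    -- ★ K6c's letters
    (hjiso : ∀ a, Valued.v (jE a) = Valued.v a) {tM : ℕ} (hDM : IsRamifiedQuadraticDatum Θ (jE ϖ) d tM) (h2M : Valued.v (2 : M) < 1)
    (hFN : ∀ f' : M, ρ f' = f' → Θ f' = f' → Valued.v f' = 1 → ∃ z : M, z * Θ z = f')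
    {θ₀ : M} (hΘθ₀ : Θ θ₀ = θ₀) (hθ1 : Valued.v θ₀ ≤ 1) (hθρ : Valued.v (θ₀ - ρ θ₀) = 1) (hram : Valued.v (α - Θ α) < 1) (hmb : mstarOfRecord d ≤ 2 * b)
    {α₁ γ₁ : E} (hσα : σ α₁ = α₁) (hα1' : Valued.v α₁ = 1) (hσγ : σ γ₁ = γ₁) {g : ℕ} (hγ : Valued.v γ₁ = Valued.v ϖ ^ (2 * g)) (hg1 : 1 ≤ g) (hgd : g + 1 ≤ d)
    (Rd : Finset E) (hRd1 : ∀ V ∈ Rd, σ V = V ∧ Valued.v V ≤ 1)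
    (hRd2 : ∀ V : E, σ V = V → Valued.v V ≤ 1 → ∃ V₀ ∈ Rd, Valued.v (V - V₀) ≤ Valued.v ϖ ^ (2 * d))
    (hRd3 : ∀ V ∈ Rd, ∀ V' ∈ Rd, Valued.v (V - V') ≤ Valued.v ϖ ^ (2 * d) → V = V')
    (R' : Finset E) (hR'1 : ∀ V ∈ R', σ V = V ∧ Valued.v V ≤ 1)
    (hR'2 : ∀ V : E, σ V = V → Valued.v V ≤ 1 → ∃ V₀ ∈ R', Valued.v (V - V₀) ≤ Valued.v ϖ ^ (2 * (d - g)))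
    (hR'3 : ∀ V ∈ R', ∀ V' ∈ R', Valued.v (V - V') ≤ Valued.v ϖ ^ (2 * (d - g)) → V = V')
    (hfinLS : (levelSet ρ Θ α (jE ϖ) h b b).Finite) (ε : Prop) (P₁ Q₁ : AddSubgroup M → Prop)
    -- the reads
    (hP : ∀ (Λ : AddSubgroup M) (x₀ : M), (x₀ ≠ 0 ∧ (∀ x, x ∈ Λ ↔ ∃ ζ, IsOrd ρ α (jE ϖ ^ b) ζ ∧ x = x₀ * ζ) ∧
        IsOrd ρ α (jE ϖ ^ b) (dualGen ρ Θ α (jE ϖ ^ b) h x₀) ∧ ¬ IsOrd ρ α (jE ϖ ^ b) (dualGen ρ Θ α (jE ϖ ^ b) h x₀ / jE ϖ) ∧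
        Valued.v (dualGen ρ Θ α (jE ϖ ^ b) h x₀) = Valued.v (jE ϖ) ^ b) →
      (f b b Λ ≠ 0 ↔ ((∃ c : M, ρ c = c ∧ c * Θ c = (((α - ρ α) * Θ (α - ρ α)) * (h * (x₀ * Θ x₀)))⁻¹ + ρ (((α - ρ α) * Θ (α - ρ α)) * (h * (x₀ * Θ x₀)))⁻¹) ↔ ε)))
    (hL₁ : ∀ (Λ : AddSubgroup M) (x₀ : M), (x₀ ≠ 0 ∧ (∀ x, x ∈ Λ ↔ ∃ ζ, IsOrd ρ α (jE ϖ ^ b) ζ ∧ x = x₀ * ζ) ∧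
        IsOrd ρ α (jE ϖ ^ b) (dualGen ρ Θ α (jE ϖ ^ b) h x₀) ∧ ¬ IsOrd ρ α (jE ϖ ^ b) (dualGen ρ Θ α (jE ϖ ^ b) h x₀ / jE ϖ) ∧
        Valued.v (dualGen ρ Θ α (jE ϖ ^ b) h x₀) = Valued.v (jE ϖ) ^ b) → f b b Λ ≠ 0 →
      (P₁ Λ ↔ ∃ Ve : E, jE Ve = (θ₀ * (((α - ρ α) * Θ (α - ρ α)) * (h * (x₀ * Θ x₀)))⁻¹ + ρ (θ₀ * (((α - ρ α) * Θ (α - ρ α)) * (h * (x₀ * Θ x₀)))⁻¹)) /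
          ((((α - ρ α) * Θ (α - ρ α)) * (h * (x₀ * Θ x₀)))⁻¹ + ρ (((α - ρ α) * Θ (α - ρ α)) * (h * (x₀ * Θ x₀)))⁻¹) ∧ normSign σ (α₁ + γ₁ * Ve) = 1))
    (hL₂ : ∀ (Λ : AddSubgroup M) (x₀ : M), (x₀ ≠ 0 ∧ (∀ x, x ∈ Λ ↔ ∃ ζ, IsOrd ρ α (jE ϖ ^ b) ζ ∧ x = x₀ * ζ) ∧
        IsOrd ρ α (jE ϖ ^ b) (dualGen ρ Θ α (jE ϖ ^ b) h x₀) ∧ ¬ IsOrd ρ α (jE ϖ ^ b) (dualGen ρ Θ α (jE ϖ ^ b) h x₀ / jE ϖ) ∧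
        Valued.v (dualGen ρ Θ α (jE ϖ ^ b) h x₀) = Valued.v (jE ϖ) ^ b) → f b b Λ ≠ 0 →
      (Q₁ Λ ↔ ∃ Ve : E, jE Ve = (θ₀ * (((α - ρ α) * Θ (α - ρ α)) * (h * (x₀ * Θ x₀)))⁻¹ + ρ (θ₀ * (((α - ρ α) * Θ (α - ρ α)) * (h * (x₀ * Θ x₀)))⁻¹)) /
          ((((α - ρ α) * Θ (α - ρ α)) * (h * (x₀ * Θ x₀)))⁻¹ + ρ (((α - ρ α) * Θ (α - ρ α)) * (h * (x₀ * Θ x₀)))⁻¹) ∧ ¬ normSign σ (α₁ + γ₁ * Ve) = 1)) :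
    ((∑ᶠ Λ ∈ levelSetDep ρ Θ α (jE ϖ) h b b (lam - jE u) ∩ {Λ | P₁ Λ}, f b b Λ : ℕ) : ℤ) -
      ((∑ᶠ Λ ∈ levelSetDep ρ Θ α (jE ϖ) h b b (lam - jE u) ∩ {Λ | Q₁ Λ}, f b b Λ : ℕ) : ℤ) = 0 := by
  have hρϖ : ρ (jE ϖ) = jE ϖ := (hjfix _).2 ⟨ϖ, rfl⟩
  have hϖM : Valued.v (jE ϖ) = exp (-1 : ℤ) := by rw [hjiso, hϖ]
  rw [sub_eq_zero, Nat.cast_inj]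
  refine (finsum_levelSetDep_inter_weight_eq_iff_of_le σ hσ hvσ hϖ hD h2v hH₂σ hhW hhWσ jE hρρ hvρ hα hα1 hint hΘΘ hΘρ hvΘ hΘj hjv hjfix hjpow hϖmax
    φ hφs hφi hφo hφγ hlam hΘh hh hform u hb hdb hlamb f hf P₁ Q₁).2 ?_
  rw [sep_pop_eq_setOf_gen_of_reads hρρ hvρ hΘΘ hΘρ hvΘ hα1 hU hρϖ hϖM hh hm hjl hb h2b (f b b)
      (fun x₀ : M => ∃ c : M, ρ c = c ∧ c * Θ c = (((α - ρ α) * Θ (α - ρ α)) * (h * (x₀ * Θ x₀)))⁻¹ + ρ (((α - ρ α) * Θ (α - ρ α)) * (h * (x₀ * Θ x₀)))⁻¹)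
      (fun x₀ : M => (θ₀ * (((α - ρ α) * Θ (α - ρ α)) * (h * (x₀ * Θ x₀)))⁻¹ + ρ (θ₀ * (((α - ρ α) * Θ (α - ρ α)) * (h * (x₀ * Θ x₀)))⁻¹)) /
          ((((α - ρ α) * Θ (α - ρ α)) * (h * (x₀ * Θ x₀)))⁻¹ + ρ (((α - ρ α) * Θ (α - ρ α)) * (h * (x₀ * Θ x₀)))⁻¹))
      ε jE (fun Ve : E => normSign σ (α₁ + γ₁ * Ve) = 1) P₁ hP hL₁,
    sep_pop_eq_setOf_gen_of_reads hρρ hvρ hΘΘ hΘρ hvΘ hα1 hU hρϖ hϖM hh hm hjl hb h2b (f b b)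
      (fun x₀ : M => ∃ c : M, ρ c = c ∧ c * Θ c = (((α - ρ α) * Θ (α - ρ α)) * (h * (x₀ * Θ x₀)))⁻¹ + ρ (((α - ρ α) * Θ (α - ρ α)) * (h * (x₀ * Θ x₀)))⁻¹)
      (fun x₀ : M => (θ₀ * (((α - ρ α) * Θ (α - ρ α)) * (h * (x₀ * Θ x₀)))⁻¹ + ρ (θ₀ * (((α - ρ α) * Θ (α - ρ α)) * (h * (x₀ * Θ x₀)))⁻¹)) /
          ((((α - ρ α) * Θ (α - ρ α)) * (h * (x₀ * Θ x₀)))⁻¹ + ρ (((α - ρ α) * Θ (α - ρ α)) * (h * (x₀ * Θ x₀)))⁻¹))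
      ε jE (fun Ve : E => ¬ normSign σ (α₁ + γ₁ * Ve) = 1) Q₁ hP hL₂]
  exact ncard_cls_affine_eq_ncard_cls_not_affine hD h2v hσα hα1' hσγ hγ hg1 hgd Rd hRd1 hRd2 hRd3 R' hR'1 hR'2 hR'3 jE hjiso hjfix hΘj hDM h2M
    hρρ hvρ hΘρ hFN hΘθ₀ hθ1 hθρ hU hα1 hram hΘh hdb hmb ε hfinLS

end Summit.HodgeConjecture.HodgeConjecture.Cruxes.H413.F0P3cDyRamDiagonalCellRowSocket

end
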